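import Summits.AtomisticToContinuum.HydrodynamicLimit.Theorems.AntiMazurCoboundariesCorrectorPressureDecayKiferWallGibbsSanityCore

/-!
# The DLR equation of a hard-sphere Gibbs state for functions (disintegration along the specification)

Helper file (Core, 2/2) of crux stmt-AtomisticToContinuum-14135 `AntiMazurCoboundaries.CorrectorPressureDecay`, line
`FirstLemma` (idea `kifer-compactification`), namespace `…Theorems.KiferCompactification`; registered stub
`stub_lintegral_isHardSphereGibbs_disintegration`; serves the wall sanity check `stub_gibbsFastBiasVanishes`.
Reusable summit-wide (every argument about `Literature.Analysis.FluidPDE.IsHardSphereGibbs` beyond indicators needs it):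

* the specification as a MEASURE `gibbsSpecMeasure ε z β u Λ Y` on configurations (`gibbsWeightMeasure`: the
  un-normalised weight as a countable sum of push-forwards of the restricted `k`-particle a-priori laws;
  `gibbsWeightMeasure_apply = gibbsWeight`, `gibbsSpecMeasure_apply = gibbsSpec`, `lintegral_gibbsWeightMeasure`),
  measurable in `Y` (`measurable_gibbsWeight`, `measurable_gibbsSpec`, `measurable_gibbsSpecMeasure`), with
  `1 ≤ gibbsWeight … Y univ` (`one_le_gibbsWeight_univ`: the empty insertion is hard-core compatible);
* the DLR equation for functions: `μ.bind (gibbsSpecMeasure …) = μ` (`bind_gibbsSpecMeasure_of_isHardSphereGibbs`), hence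
  `∫⁻ F ∂μ = ∫⁻ Y, ∫⁻ F ∂γ_Λ(·|Y) ∂μ` (`lintegral_eq_lintegral_gibbsSpecMeasure`), and `gibbsWeight … Y univ < ∞`,
  `γ_Λ(·|Y)` a probability measure, for `μ`-a.e. `Y` (`ae_gibbsWeight_univ_ne_top`);
* the intensity bound `E_μ[#(particles above Λ)] ≤ ∑ₖ (zᵏ/k!) k m(Λ × ℝᵈ)ᵏ < ∞` (`lintegral_count_le_of_isHardSphereGibbs`,
  `tsum_ofReal_pow_div_factorial_mul_lt_top`).
-/

noncomputable section

open MeasureTheory ProbabilityTheory Set Filter Topology Function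
open scoped ENNReal

namespace Summit.AtomisticToContinuum.HydrodynamicLimit.Theorems.KiferCompactification

open Literature.Analysis.FluidPDE (IsHardSphereGibbs HardCoreIn superposeIn gibbsWeight gibbsSpec maxwellPhaseMeasure
  particlesIn mem_particlesIn_iff)
open Literature.Analysis.FunctionSpaces (PointConfig)
open Literature.MathematicalPhysics.KineticTheory (V3)

/-! ## The specification as a measure; measurability in the boundary condition -/

section Specification

/-- The one-particle a-priori measure is σ-finite (a plain theorem, used via `haveI`). -/
theorem sigmaFinite_maxwellPhaseMeasure (β : ℝ) (u : V3) (Λ : Set V3) : SigmaFinite (maxwellPhaseMeasure β u Λ) := by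
  unfold Literature.Analysis.FluidPDE.maxwellPhaseMeasure
  infer_instance

/-- The integrand of the `k`-th term of `gibbsWeight`, in coordinates: the indicator of
`{x | superposeIn Λ x Y ∈ A} ∩ {x | hard core}`. -/
theorem gibbsWeight_integrand_eq (ε : ℝ) (Λ : Set V3) (Y : PointConfig (V3 × V3)) (A : Set (PointConfig (V3 × V3)))
    {k : ℕ} (x : Fin k → V3 × V3) :
    (A ∩ {X | HardCoreIn ε Λ X}).indicator (1 : PointConfig (V3 × V3) → ℝ≥0∞) (superposeIn Λ x Y) =
      ((fun x : Fin k → V3 × V3 => superposeIn Λ x Y) ⁻¹' A ∩ {x | HardCoreIn ε Λ (superposeIn Λ x Y)}).indicator 1 x :=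
  rfl

/-- The integrand of `gibbsWeight … Y A` is jointly measurable in the thrown points and the boundary condition. -/
theorem measurable_gibbsWeight_integrand (ε : ℝ) {Λ : Set V3} (hΛ : MeasurableSet Λ)
    {A : Set (PointConfig (V3 × V3))} (hA : MeasurableSet A) (k : ℕ) :
    Measurable fun p : (Fin k → V3 × V3) × PointConfig (V3 × V3) =>
      (A ∩ {X | HardCoreIn ε Λ X}).indicator (1 : PointConfig (V3 × V3) → ℝ≥0∞) (superposeIn Λ p.1 p.2) :=
  (measurable_one.indicator (hA.inter (measurableSet_hardCoreIn ε hΛ))).comp (measurable_superposeIn hΛ k)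

/-- **The grand-canonical weight depends measurably on the boundary condition** (measurability part of Fubini,
term by term). -/
theorem measurable_gibbsWeight (ε z β : ℝ) (u : V3) {Λ : Set V3} (hΛ : MeasurableSet Λ)
    {A : Set (PointConfig (V3 × V3))} (hA : MeasurableSet A) :
    Measurable fun Y : PointConfig (V3 × V3) => gibbsWeight ε z β u Λ Y A := by
  haveI := sigmaFinite_maxwellPhaseMeasure β u Λ
  unfold Literature.Analysis.FluidPDE.gibbsWeight
  refine Measurable.tsum fun k => Measurable.const_mul ?_ _
  exact (measurable_gibbsWeight_integrand ε hΛ hA k).lintegral_prod_left'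

/-- **The specification `Y ↦ γ_Λ(A | Y)` is measurable** for measurable `Λ`, `A`. -/
theorem measurable_gibbsSpec (ε z β : ℝ) (u : V3) {Λ : Set V3} (hΛ : MeasurableSet Λ)
    {A : Set (PointConfig (V3 × V3))} (hA : MeasurableSet A) :
    Measurable fun Y : PointConfig (V3 × V3) => gibbsSpec ε z β u Λ Y A := by
  unfold Literature.Analysis.FluidPDE.gibbsSpec
  exact (measurable_gibbsWeight ε z β u hΛ hA).div (measurable_gibbsWeight ε z β u hΛ MeasurableSet.univ)

/-- **The un-normalised grand-canonical weight as a measure** on configurations: the countable sum over `k` of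
`(zᵏ/k!) ·` the push-forward under `x ↦ superposeIn Λ x Y` of the `k`-particle a-priori law restricted to the hard-core
event. -/
def gibbsWeightMeasure (ε z β : ℝ) (u : V3) (Λ : Set V3) (Y : PointConfig (V3 × V3)) : Measure (PointConfig (V3 × V3)) :=
  Measure.sum fun k : ℕ => ENNReal.ofReal (z ^ k / (Nat.factorial k)) •
    ((Measure.pi fun _ : Fin k => maxwellPhaseMeasure β u Λ).restrict
      {x | HardCoreIn ε Λ (superposeIn Λ x Y)}).map (fun x => superposeIn Λ x Y)

/-- The weight measure evaluates to `gibbsWeight` on measurable events. -/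
theorem gibbsWeightMeasure_apply (ε z β : ℝ) (u : V3) {Λ : Set V3} (hΛ : MeasurableSet Λ) (Y : PointConfig (V3 × V3))
    {A : Set (PointConfig (V3 × V3))} (hA : MeasurableSet A) :
    gibbsWeightMeasure ε z β u Λ Y A = gibbsWeight ε z β u Λ Y A := by
  rw [gibbsWeightMeasure, Measure.sum_apply _ hA]
  unfold Literature.Analysis.FluidPDE.gibbsWeight
  refine tsum_congr fun k => ?_
  have hf := measurable_superposeIn_left hΛ k Y
  rw [Measure.smul_apply, smul_eq_mul, Measure.map_apply hf hA, Measure.restrict_apply (hA.preimage hf),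
    ← lintegral_indicator_one ((hA.preimage hf).inter (measurableSet_hardCoreIn_superposeIn_left ε hΛ k Y))]
  simp_rw [gibbsWeight_integrand_eq]

/-- Integration against the weight measure, term by term. -/
theorem lintegral_gibbsWeightMeasure (ε z β : ℝ) (u : V3) {Λ : Set V3} (hΛ : MeasurableSet Λ)
    (Y : PointConfig (V3 × V3)) {F : PointConfig (V3 × V3) → ℝ≥0∞} (hF : Measurable F) :
    ∫⁻ X, F X ∂(gibbsWeightMeasure ε z β u Λ Y) = ∑' k : ℕ, ENNReal.ofReal (z ^ k / (Nat.factorial k)) *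
      ∫⁻ x in {x | HardCoreIn ε Λ (superposeIn Λ x Y)}, F (superposeIn Λ x Y)
        ∂(Measure.pi fun _ : Fin k => maxwellPhaseMeasure β u Λ) := by
  rw [gibbsWeightMeasure, lintegral_sum_measure]
  refine tsum_congr fun k => ?_
  rw [lintegral_smul_measure, smul_eq_mul, lintegral_map hF (measurable_superposeIn_left hΛ k Y)]

/-- With no particle thrown, the superposition is hard-core compatible in `Λ`, so the `k = 0` term of the weight of
`univ` is `1`: **`1 ≤ gibbsWeight … Y univ`** for every boundary condition. -/
theorem one_le_gibbsWeight_univ (ε z β : ℝ) (u : V3) (Λ : Set V3) (Y : PointConfig (V3 × V3)) :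
    1 ≤ gibbsWeight ε z β u Λ Y univ := by
  haveI := sigmaFinite_maxwellPhaseMeasure β u Λ
  unfold Literature.Analysis.FluidPDE.gibbsWeight
  refine le_trans ?_ (ENNReal.le_tsum 0)
  have hind : ∀ x : Fin 0 → V3 × V3, (univ ∩ {X | HardCoreIn ε Λ X}).indicator (1 : PointConfig (V3 × V3) → ℝ≥0∞)
      (superposeIn Λ x Y) = 1 := fun x =>
    Set.indicator_of_mem (show superposeIn Λ x Y ∈ univ ∩ {X | HardCoreIn ε Λ X} from
      ⟨mem_univ _, Literature.MathematicalPhysics.StatisticalMechanics.hardCoreIn_superposeIn_zero ε Λ x Y⟩) _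
  simp_rw [hind]
  rw [lintegral_const, Measure.pi_univ, Finset.univ_eq_empty, Finset.prod_empty, pow_zero, Nat.factorial_zero,
    Nat.cast_one, div_one, ENNReal.ofReal_one, one_mul, mul_one]

/-- The weight of `univ` never vanishes. -/
theorem gibbsWeight_univ_ne_zero (ε z β : ℝ) (u : V3) (Λ : Set V3) (Y : PointConfig (V3 × V3)) :
    gibbsWeight ε z β u Λ Y univ ≠ 0 :=
  (lt_of_lt_of_le one_pos (one_le_gibbsWeight_univ ε z β u Λ Y)).ne'

/-- **The finite-volume Gibbs specification `γ_Λ(· | Y)` as a measure** on configurations: the normalised weight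
measure. -/
def gibbsSpecMeasure (ε z β : ℝ) (u : V3) (Λ : Set V3) (Y : PointConfig (V3 × V3)) : Measure (PointConfig (V3 × V3)) :=
  (gibbsWeight ε z β u Λ Y univ)⁻¹ • gibbsWeightMeasure ε z β u Λ Y

/-- The specification measure evaluates to `gibbsSpec` on measurable events. -/
theorem gibbsSpecMeasure_apply (ε z β : ℝ) (u : V3) {Λ : Set V3} (hΛ : MeasurableSet Λ) (Y : PointConfig (V3 × V3))
    {A : Set (PointConfig (V3 × V3))} (hA : MeasurableSet A) :
    gibbsSpecMeasure ε z β u Λ Y A = gibbsSpec ε z β u Λ Y A := by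
  rw [gibbsSpecMeasure, Measure.smul_apply, smul_eq_mul, gibbsWeightMeasure_apply ε z β u hΛ Y hA,
    Literature.Analysis.FluidPDE.gibbsSpec, ENNReal.div_eq_inv_mul]

/-- Integration against the specification measure. -/
theorem lintegral_gibbsSpecMeasure (ε z β : ℝ) (u : V3) (Λ : Set V3) (Y : PointConfig (V3 × V3))
    (F : PointConfig (V3 × V3) → ℝ≥0∞) :
    ∫⁻ X, F X ∂(gibbsSpecMeasure ε z β u Λ Y) =
      (gibbsWeight ε z β u Λ Y univ)⁻¹ * ∫⁻ X, F X ∂(gibbsWeightMeasure ε z β u Λ Y) := by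
  rw [gibbsSpecMeasure, lintegral_smul_measure, smul_eq_mul]

/-- **The specification is a measurable kernel in the boundary condition.** -/
theorem measurable_gibbsSpecMeasure (ε z β : ℝ) (u : V3) {Λ : Set V3} (hΛ : MeasurableSet Λ) :
    Measurable (gibbsSpecMeasure ε z β u Λ) := by
  refine Measure.measurable_of_measurable_coe _ fun A hA => ?_
  simp_rw [gibbsSpecMeasure_apply ε z β u hΛ _ hA]
  exact measurable_gibbsSpec ε z β u hΛ hA

/-- The specification measure has total mass `≤ 1`. -/
theorem gibbsSpecMeasure_univ_le_one (ε z β : ℝ) (u : V3) {Λ : Set V3} (hΛ : MeasurableSet Λ) (Y : PointConfig (V3 × V3)) :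
    gibbsSpecMeasure ε z β u Λ Y univ ≤ 1 := by
  rw [gibbsSpecMeasure_apply ε z β u hΛ Y MeasurableSet.univ, Literature.Analysis.FluidPDE.gibbsSpec]
  exact ENNReal.div_self_le_one

/-- If the weight of `univ` is finite, the specification measure is a probability measure (a plain theorem). -/
theorem isProbabilityMeasure_gibbsSpecMeasure (ε z β : ℝ) (u : V3) {Λ : Set V3} (hΛ : MeasurableSet Λ)
    {Y : PointConfig (V3 × V3)} (hY : gibbsWeight ε z β u Λ Y univ ≠ ∞) :
    IsProbabilityMeasure (gibbsSpecMeasure ε z β u Λ Y) := by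
  refine ⟨?_⟩
  rw [gibbsSpecMeasure, Measure.smul_apply, smul_eq_mul, gibbsWeightMeasure_apply ε z β u hΛ Y MeasurableSet.univ]
  exact ENNReal.inv_mul_cancel (gibbsWeight_univ_ne_zero ε z β u Λ Y) hY

/-! ## The DLR equation for functions -/

/-- **DLR as a fixed-point equation**: a hard-sphere Gibbs state is invariant under its specification kernel,
`μ.bind γ_Λ = μ`, for every bounded measurable window. -/
theorem bind_gibbsSpecMeasure_of_isHardSphereGibbs {ε z β : ℝ} {u : V3} {μ : Measure (PointConfig (V3 × V3))}
    (h : IsHardSphereGibbs ε z β u μ) {Λ : Set V3} (hΛ : MeasurableSet Λ) (hΛb : Bornology.IsBounded Λ) :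
    μ.bind (gibbsSpecMeasure ε z β u Λ) = μ := by
  ext A hA
  rw [Measure.bind_apply hA (measurable_gibbsSpecMeasure ε z β u hΛ).aemeasurable, h.2 Λ hΛ hΛb A hA]
  simp_rw [gibbsSpecMeasure_apply ε z β u hΛ _ hA]

/-- **The DLR equation for functions** (disintegration of a Gibbs state along its specification):
`∫⁻ F ∂μ = ∫⁻ Y, ∫⁻ F ∂γ_Λ(·|Y) ∂μ` for every `μ`-a.e.-measurable `F ≥ 0`. -/
theorem lintegral_eq_lintegral_gibbsSpecMeasure {ε z β : ℝ} {u : V3}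
    {μ : Measure (PointConfig (V3 × V3))} (h : IsHardSphereGibbs ε z β u μ) {Λ : Set V3} (hΛ : MeasurableSet Λ)
    (hΛb : Bornology.IsBounded Λ) {F : PointConfig (V3 × V3) → ℝ≥0∞} (hF : AEMeasurable F μ) :
    ∫⁻ X, F X ∂μ = ∫⁻ Y, ∫⁻ X, F X ∂(gibbsSpecMeasure ε z β u Λ Y) ∂μ := by
  have hb := bind_gibbsSpecMeasure_of_isHardSphereGibbs h hΛ hΛb
  have hF' : AEMeasurable F (μ.bind (gibbsSpecMeasure ε z β u Λ)) := by rwa [hb]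
  calc ∫⁻ X, F X ∂μ = ∫⁻ X, F X ∂(μ.bind (gibbsSpecMeasure ε z β u Λ)) := by rw [hb]
    _ = ∫⁻ Y, ∫⁻ X, F X ∂(gibbsSpecMeasure ε z β u Λ Y) ∂μ :=
        Measure.lintegral_bind (measurable_gibbsSpecMeasure ε z β u hΛ).aemeasurable hF'

/-- A `μ`-a.e. property of configurations holds `γ_Λ(·|Y)`-a.e. for `μ`-a.e. boundary condition `Y`. -/
theorem ae_ae_gibbsSpecMeasure_of_ae {ε z β : ℝ} {u : V3} {μ : Measure (PointConfig (V3 × V3))}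
    (h : IsHardSphereGibbs ε z β u μ) {Λ : Set V3} (hΛ : MeasurableSet Λ) (hΛb : Bornology.IsBounded Λ)
    {p : PointConfig (V3 × V3) → Prop} (hp : ∀ᵐ X ∂μ, p X) : ∀ᵐ Y ∂μ, ∀ᵐ X ∂(gibbsSpecMeasure ε z β u Λ Y), p X := by
  have hb := bind_gibbsSpecMeasure_of_isHardSphereGibbs h hΛ hΛb
  have hp' : ∀ᵐ X ∂(μ.bind (gibbsSpecMeasure ε z β u Λ)), p X := by rwa [hb]
  exact Measure.ae_ae_of_ae_bind (measurable_gibbsSpecMeasure ε z β u hΛ).aemeasurable hp'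

/-- **Under a Gibbs state the weight of `univ` is a.s. finite** (and `≥ 1`), so `γ_Λ(·|Y)` is a probability measure
for `μ`-a.e. `Y`: the DLR equation at `A = univ` reads `1 = ∫⁻ w/w ∂μ` with `w/w ≤ 1`. -/
theorem ae_gibbsWeight_univ_ne_top {ε z β : ℝ} {u : V3} {μ : Measure (PointConfig (V3 × V3))}
    (h : IsHardSphereGibbs ε z β u μ) {Λ : Set V3} (hΛ : MeasurableSet Λ) (hΛb : Bornology.IsBounded Λ) :
    ∀ᵐ Y ∂μ, gibbsWeight ε z β u Λ Y univ ≠ ∞ := by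
  haveI := h.1
  have hmeas := measurable_gibbsSpec ε z β u hΛ (MeasurableSet.univ : MeasurableSet (univ : Set (PointConfig (V3 × V3))))
  have hle : ∀ Y : PointConfig (V3 × V3), gibbsSpec ε z β u Λ Y univ ≤ 1 := fun Y => ENNReal.div_self_le_one
  have h1 : ∫⁻ Y, gibbsSpec ε z β u Λ Y univ ∂μ = 1 := by
    rw [← h.2 Λ hΛ hΛb univ MeasurableSet.univ, measure_univ]
  have h2 : ∫⁻ Y, (1 - gibbsSpec ε z β u Λ Y univ) ∂μ = 0 := by
    rw [lintegral_sub' hmeas.aemeasurable (by rw [h1]; exact ENNReal.one_ne_top) (ae_of_all _ hle), lintegral_const,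
      measure_univ, mul_one, h1, tsub_self]
  have h3 := (lintegral_eq_zero_iff' (aemeasurable_const.sub hmeas.aemeasurable)).1 h2
  filter_upwards [h3] with Y hY
  simp only [Pi.sub_apply, Pi.zero_apply, tsub_eq_zero_iff_le] at hY
  have hone : gibbsSpec ε z β u Λ Y univ = 1 := le_antisymm (hle Y) hY
  intro htop
  rw [Literature.Analysis.FluidPDE.gibbsSpec, htop, ENNReal.div_top] at hone
  exact zero_ne_one hone

/-- For `μ`-a.e. boundary condition the specification measure is a probability measure. -/
theorem ae_isProbabilityMeasure_gibbsSpecMeasure {ε z β : ℝ} {u : V3}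
    {μ : Measure (PointConfig (V3 × V3))} (h : IsHardSphereGibbs ε z β u μ) {Λ : Set V3} (hΛ : MeasurableSet Λ)
    (hΛb : Bornology.IsBounded Λ) : ∀ᵐ Y ∂μ, IsProbabilityMeasure (gibbsSpecMeasure ε z β u Λ Y) := by
  filter_upwards [ae_gibbsWeight_univ_ne_top h hΛ hΛb] with Y hY
  exact isProbabilityMeasure_gibbsSpecMeasure ε z β u hΛ hY

/-! ## The intensity of a Gibbs state above a window is finite -/

/-- Counts are measurable as `ℝ≥0∞`-valued functions of the configuration. -/
theorem measurable_toENNReal_count {s : Set (V3 × V3)} (hs : MeasurableSet s) :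
    Measurable fun X : PointConfig (V3 × V3) => ((X.count s : ℕ∞) : ℝ≥0∞) :=
  measurable_from_top.comp (PointConfig.measurable_count hs)

/-- Mean number of particles above `Λ` under the weight measure: at most `∑ₖ (zᵏ/k!) k m(Λ × ℝᵈ)ᵏ`, `m` the
one-particle a-priori measure. -/
theorem lintegral_count_gibbsWeightMeasure_le (ε z β : ℝ) (u : V3) {Λ : Set V3} (hΛ : MeasurableSet Λ)
    (Y : PointConfig (V3 × V3)) :
    ∫⁻ X, ((X.count (Λ ×ˢ (univ : Set V3)) : ℕ∞) : ℝ≥0∞) ∂(gibbsWeightMeasure ε z β u Λ Y) ≤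
      ∑' k : ℕ, ENNReal.ofReal (z ^ k / (Nat.factorial k)) * (k * (maxwellPhaseMeasure β u Λ univ) ^ k) := by
  haveI := sigmaFinite_maxwellPhaseMeasure β u Λ
  rw [lintegral_gibbsWeightMeasure ε z β u hΛ Y (measurable_toENNReal_count (hΛ.prod MeasurableSet.univ))]
  refine ENNReal.tsum_le_tsum fun k => mul_le_mul' le_rfl ?_
  calc ∫⁻ x in {x : Fin k → V3 × V3 | HardCoreIn ε Λ (superposeIn Λ x Y)},
        (((superposeIn Λ x Y).count (Λ ×ˢ (univ : Set V3)) : ℕ∞) : ℝ≥0∞) ∂(Measure.pi fun _ : Fin k => maxwellPhaseMeasure β u Λ)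
      ≤ ∫⁻ _ in {x : Fin k → V3 × V3 | HardCoreIn ε Λ (superposeIn Λ x Y)}, (k : ℝ≥0∞)
          ∂(Measure.pi fun _ : Fin k => maxwellPhaseMeasure β u Λ) := by
        refine lintegral_mono fun x => ?_
        exact (ENat.toENNReal_le.2 (count_superposeIn_prod_univ_le Λ x Y)).trans_eq (ENat.toENNReal_coe k)
    _ = k * (Measure.pi fun _ : Fin k => maxwellPhaseMeasure β u Λ) {x | HardCoreIn ε Λ (superposeIn Λ x Y)} :=
        setLIntegral_const _ _
    _ ≤ k * (Measure.pi fun _ : Fin k => maxwellPhaseMeasure β u Λ) univ := by gcongr; exact subset_univ _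
    _ = k * (maxwellPhaseMeasure β u Λ univ) ^ k := by
        rw [Measure.pi_univ, Finset.prod_const, Finset.card_univ, Fintype.card_fin]

/-- Mean number of particles above `Λ` under the specification: the same bound (the normalising weight is `≥ 1`). -/
theorem lintegral_count_gibbsSpecMeasure_le (ε z β : ℝ) (u : V3) {Λ : Set V3} (hΛ : MeasurableSet Λ)
    (Y : PointConfig (V3 × V3)) :
    ∫⁻ X, ((X.count (Λ ×ˢ (univ : Set V3)) : ℕ∞) : ℝ≥0∞) ∂(gibbsSpecMeasure ε z β u Λ Y) ≤
      ∑' k : ℕ, ENNReal.ofReal (z ^ k / (Nat.factorial k)) * (k * (maxwellPhaseMeasure β u Λ univ) ^ k) := by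
  rw [lintegral_gibbsSpecMeasure]
  calc (gibbsWeight ε z β u Λ Y univ)⁻¹ *
        ∫⁻ X, ((X.count (Λ ×ˢ (univ : Set V3)) : ℕ∞) : ℝ≥0∞) ∂(gibbsWeightMeasure ε z β u Λ Y)
      ≤ 1 * ∫⁻ X, ((X.count (Λ ×ˢ (univ : Set V3)) : ℕ∞) : ℝ≥0∞) ∂(gibbsWeightMeasure ε z β u Λ Y) :=
        mul_le_mul' (ENNReal.inv_le_one.2 (one_le_gibbsWeight_univ ε z β u Λ Y)) le_rfl
    _ ≤ _ := by rw [one_mul]; exact lintegral_count_gibbsWeightMeasure_le ε z β u hΛ Y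

/-- **Intensity bound for a Gibbs state**: `E_μ[#(particles above Λ)] ≤ ∑ₖ (zᵏ/k!) k m(Λ × ℝᵈ)ᵏ` for every bounded
measurable window. -/
theorem lintegral_count_le_of_isHardSphereGibbs {ε z β : ℝ} {u : V3} {μ : Measure (PointConfig (V3 × V3))}
    (h : IsHardSphereGibbs ε z β u μ) {Λ : Set V3} (hΛ : MeasurableSet Λ) (hΛb : Bornology.IsBounded Λ) :
    ∫⁻ X, ((X.count (Λ ×ˢ (univ : Set V3)) : ℕ∞) : ℝ≥0∞) ∂μ ≤
      ∑' k : ℕ, ENNReal.ofReal (z ^ k / (Nat.factorial k)) * (k * (maxwellPhaseMeasure β u Λ univ) ^ k) := by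
  haveI := h.1
  rw [lintegral_eq_lintegral_gibbsSpecMeasure h hΛ hΛb
    (measurable_toENNReal_count (hΛ.prod MeasurableSet.univ)).aemeasurable]
  calc ∫⁻ Y, ∫⁻ X, ((X.count (Λ ×ˢ (univ : Set V3)) : ℕ∞) : ℝ≥0∞) ∂(gibbsSpecMeasure ε z β u Λ Y) ∂μ
      ≤ ∫⁻ _, ∑' k : ℕ, ENNReal.ofReal (z ^ k / (Nat.factorial k)) * (k * (maxwellPhaseMeasure β u Λ univ) ^ k) ∂μ :=
        lintegral_mono fun Y => lintegral_count_gibbsSpecMeasure_le ε z β u hΛ Y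
    _ = _ := by rw [lintegral_const, show μ univ = 1 from measure_univ, mul_one]

/-- The bounding series is finite when the one-particle a-priori measure is finite: `zᵏ k rᵏ / k! ≤ (2zr)ᵏ/k!`. -/
theorem tsum_ofReal_pow_div_factorial_mul_lt_top {z : ℝ} (hz : 0 ≤ z) {m : ℝ≥0∞} (hm : m ≠ ∞) :
    ∑' k : ℕ, ENNReal.ofReal (z ^ k / (Nat.factorial k)) * (k * m ^ k) < ∞ := by
  set r : ℝ := m.toReal with hr
  have hr0 : 0 ≤ r := ENNReal.toReal_nonneg
  have hmr : m = ENNReal.ofReal r := (ENNReal.ofReal_toReal hm).symm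
  have hle : ∀ k : ℕ, ENNReal.ofReal (z ^ k / (Nat.factorial k)) * (k * m ^ k) ≤
      ENNReal.ofReal ((2 * z * r) ^ k / (Nat.factorial k)) := fun k => by
    rw [hmr, ← ENNReal.ofReal_pow hr0, ← ENNReal.ofReal_natCast, ← ENNReal.ofReal_mul (Nat.cast_nonneg k),
      ← ENNReal.ofReal_mul (by positivity)]
    refine ENNReal.ofReal_le_ofReal ?_
    rw [div_mul_eq_mul_div, mul_pow, mul_pow]
    refine div_le_div_of_nonneg_right ?_ (by positivity)
    have hk : (k : ℝ) ≤ 2 ^ k := by exact_mod_cast Nat.lt_two_pow_self.le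
    calc z ^ k * (k * r ^ k) = k * (z ^ k * r ^ k) := by ring
      _ ≤ 2 ^ k * (z ^ k * r ^ k) := by gcongr
      _ = 2 ^ k * z ^ k * r ^ k := by ring
  refine lt_of_le_of_lt (ENNReal.tsum_le_tsum hle) ?_
  rw [← ENNReal.ofReal_tsum_of_nonneg (fun k => by positivity) (Real.summable_pow_div_factorial _)]
  exact ENNReal.ofReal_lt_top

end Specification

/-- Registered stub `stub_lintegral_isHardSphereGibbs_disintegration` (line `FirstLemma`, helper of the wall sanity
check `stub_gibbsFastBiasVanishes`): the DLR equation of a hard-sphere Gibbs state for nonnegative measurable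
functions, `∫⁻ F ∂μ = ∫⁻ Y, ∫⁻ F ∂γ_Λ(·|Y) ∂μ`, together with the a.s. finiteness of the normalising weight. -/
theorem stub_lintegral_isHardSphereGibbs_disintegration : ∀ (ε z β : ℝ) (u : V3) (μ : Measure (PointConfig (V3 × V3))), IsHardSphereGibbs ε z β u μ → ∀ (Λ : Set V3), MeasurableSet Λ → Bornology.IsBounded Λ → (∀ᵐ Y ∂μ, gibbsWeight ε z β u Λ Y univ ≠ ⊤ ∧ IsProbabilityMeasure (gibbsSpecMeasure ε z β u Λ Y)) ∧ ∀ (F : PointConfig (V3 × V3) → ℝ≥0∞), Measurable F → ∫⁻ X, F X ∂μ = ∫⁻ Y, ∫⁻ X, F X ∂(gibbsSpecMeasure ε z β u Λ Y) ∂μ := by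
  intro ε z β u μ h Λ hΛ hΛb
  refine ⟨?_, fun F hF => lintegral_eq_lintegral_gibbsSpecMeasure h hΛ hΛb hF.aemeasurable⟩
  filter_upwards [ae_gibbsWeight_univ_ne_top h hΛ hΛb] with Y hY
  exact ⟨hY, isProbabilityMeasure_gibbsSpecMeasure ε z β u hΛ hY⟩


end Summit.AtomisticToContinuum.HydrodynamicLimit.Theorems.KiferCompactification
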